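import Summits.ResolutionOfSingularities.ResolutionOfSingularities.Theorems.MarkedTransferCampaignG1PnegaSqueezeF2
import HarnessLib

/-!
# [OURS · L1 G1] The `℘nega` INTERFACE, v0.7 = `Campaign.PnegaInterfaceV4` (res-D-plan-1's rev 0.7 «V3.2», Lean name V4 per their
# INTERFACE ANSWER 03:12:54Z; DEPOSITED 2026-08-27T03:07:07Z as `D/res-D-plan-1/PnegaInterface.v07.draft.lean` sha16 709f127e58cf5a8f: «V3 AS FILED p487629 with THREE changes»; carried
# summit-side by the typer of record res-L1-type-o2 as a NEW SIBLING of `…G1PnegaInterfaceV3.lean` — the gate's decl-level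
# append-only rule forbids mutating / dropping fields of `PnegaInterfaceV3` in place)

THE THREE CHANGES over `PnegaInterfaceV3` (p487629, tree sha16 8aba1d9ea9dcdcd9); record `D/res-D-plan-1/PNEGA-INTERFACE-v0.3-delta.md`:
* C8′ (res-adj-1 Q-G 02:46:11Z, res-D-plan-1 02:53:48Z) — F8 `antitone_nonpos` reads `i ≤ j → j < 0 → …`: degree 0 ISOLATED (print has
  `1 ∈ ℘(E,0) ⊆ ℘̃(E,0)`, Th 4.1; V3's edge `j = 0` + F7b-unit demanded a unit-free degree-0 piece — artefact «E-G», unscored).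
* F3⁻ LEAVES THE STRUCTURE (rev 0.7; driver res-D-pv-031 §7 (iii) `PnegaObligation.tilde_neg_eq_bot_of_F3hs_of_negProper`, p490404): ANY
  blanket Diff-stability on negative SOURCES — Grothendieck (F3⁻) or Hasse–Schmidt (F3hs) — with F7b-unit forces EVERY negative piece to
  `⊥` at a regular local placement with an adapted HS system (Krull; no NormDemand / Frobenius / `O`-stability): with F3⁻ a FIELD,
  «inhabitant ⇒ ¬ NonVanishing» is a theorem (`PnegaInterfaceV3.not_nonVanishing_of_hsLocalDatum`) and the checklist could only certify
  death. F3⁻ is print-DERIVED, not a consumer demand (consumers = obligations F3.1–F3.4), so it becomes the SCORED PREDICATE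
  `PnegaInterfaceV4.DiffStableNeg` (cell F3⁻: ✗-class for every F7b ∧ F7c candidate; forced for no one), with `bypass_diffStableNeg`.
* E-H (res-D-pv-031; res-D-plan-1 02:50:27Z (1)) recorded as `PnegaInterfaceV4.mul_mem_neg` UNDER `(h : I.DiffStableNeg)` (`Diff^{(0)}`
  contains every multiplication, `Resolution.isDiffOpLE_mulLeft`; with F6d-elt the squeeze empties the negative pieces — res-type-087
  SqueezeV3 p488544; over V3 hypothesis-free: `PnegaInterfaceV3.tilde_neg_eq_bot_of_normDemand`, `…ObligationF3hs.lean` v2).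
The structure lists only demands read downstream: F2 (`pos_eq`, `mul_mem`), F8⁻, F9, F7b-unit, F1, F4, F6a; scored predicates =
`DiffStableNeg` · `OStable` · `NormDemand` · `PnegaInterfaceV3.NormDemandGen` · `NonVanishing` · obligations F31/F32/F33/F34 · F3hs.
READING FOR THE RECORD (res-D-plan-1 03:44:20Z (2), instrument, no verdict on print): the consumed demand-set {F2 product rule across the
sign boundary, F8⁻ antitone below 0, F6d-elt} EXCLUDES every non-zero negative piece at every regular local placement of positive dimension
(§5; OBSTRUCTION LIST #1 p488923 · #2 p489928 · #3 p491141 · #4 p492397 · K13-1 p492822) — a scoring table over V4 shows NO row with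
(F6d-elt ✓ ∧ F7c ✓) among inhabitants, and that is the finding; «V4 ∧ NonVanishing ∧ ¬NormDemand inhabited at a non-empty provenance?»
remains open (module-valued / F6d-gen candidates, e.g. res-type-087's data-level PW p492701, are scored outside the structure).

REUSED BY IMPORT: `Campaign.IsCharFiltration`, `PnegaInterfaceV3.{emptyProvenance, bypassTilde (+_of_pos/_of_nonpos), NormDemandGen}`.
CONTENTS (texts as in V3): §1 structure; §2 `DiffStableNeg`, `NormDemand`, `OStable`, `NonVanishing`, `antitone_pos`,
`neg_ne_top_of_neg_proper`, `mul_mem_neg` (under `DiffStableNeg`); §3 `bypass` = B6 SATISFIABILITY WITNESS (director-resolution 01:55:25Z (1))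
+ `nonempty_bypass`, `bypass_oStable/_normDemand/_not_nonVanishing_of_datum/_diffStableNeg`; §4 bridge `PnegaInterfaceV3.toV4` (every V3
inhabitant is a V4 inhabitant with the SAME `tilde`, and is `DiffStableNeg`; predicates transfer by `Iff.rfl`); §5 THE INSTRUMENT'S HEADLINE
(res-D-plan-1 INTERFACE RULING — V4 FIELD LIST FINAL 2026-08-27T03:44:20Z (1)–(2): `mul_mem` and `antitone_nonpos` STAY fields, consumer-side
per res-adj-1 DELTA 4 (a)): `not_nonVanishing_of_normDemand` — F2 at degrees `(1, −a−1)` + F8⁻ at `−2 ≤ −1` + F6d-elt (`p^e ≥ 2`) EXCLUDE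
F7c for EVERY inhabitant over every field, through res-type-087's OBSTRUCTION #3/#4 kernel (p492397) at the origin placement `K[x]_{(x)}`;
NO Diff-stability, NO `OStable` used. The obligations F3.1–F3.4 / F3hs and the `DiffStableNeg` cells over V4 live in the sibling
`MarkedTransferCampaignG1PnegaInterfaceV4Cells.lean` (400-line cap).
LANE NITS on V3 folded (res-L1-ref-b3 #83). SCORING: V3 p487629 = instrument of record for the 08:00Z check-in; V4 supersedes its ROLE
from this filing on; field / predicate NAMES unchanged (plus `DiffStableNeg`), so score lines keep their grammar.

HONEST FRAMING. Nothing here is a statement of H. Hironaka's manuscript *Resolution of singularities in positive characteristics*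
(2017-03-23, [Hironaka2017], lit key `paper:url-3343fd9e678b`): every printed item named is a CANDIDATE [claim: Hironaka2017, status:
under-review] and enters only as the SHAPE of a property a replacement must have; no field is asserted for any candidate for the
manuscript's `℘nega`; the only inhabitant exhibited is the diagnostic «⊥-bypass», nobody's candidate. OURS; AI typing weaker than
expert review; nothing here is progress on resolution of singularities in positive characteristic; no claim beyond the kernel.
-/
noncomputable section

set_option linter.dupNamespace false -- mandated namespace of this single-conjunct summit

namespace Summit.ResolutionOfSingularities.ResolutionOfSingularities.Theorems.Campaign

open Literature.AlgebraicGeometry.Resolution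
open Literature.AlgebraicGeometry.Hironaka2017
open Literature.AlgebraicGeometry.Hironaka2017.S11CoordFree (BlSub)

universe u v w
/-! ## §1 The structure (v0.7 = V4 (rev 0.7)) -/
/-- [OURS · L1 G1 ℘nega-INTERFACE — THE CHECKLIST, v0.6 = V4 (rev 0.7)] replaces the role of «what §§6–7 and §§13–16 consume of
`℘̃(E,·) / ℘nega(E,−a)`»: the V2 checklist (`MarkedTransferCampaignG1PnegaInterfaceV2.lean`, field docstrings and sources there)
with res-adj-1's corrections C1–C4 (2026-08-27T01:41:03Z) and res-D-plan-1's C5–C7 — IDENTICAL to `PnegaInterfaceV3` (p487629)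
EXCEPT rev 0.6 C8′ (F8 `antitone_nonpos` restricted to NEGATIVE degrees `i ≤ j < 0`, degree 0 isolated) and rev 0.7 (F3⁻ is NO LONGER a
field: blanket negative-source Diff-stability = the scored predicate `DiffStableNeg`; the consumers' Diff demands = obligations
F3.1–F3.4). Every `P`-quantified field GUARDED by `IsCharFiltration K P`; F5 removed (O5); cross-boundary antitonicity = obligation O6;
F9 for `i ≤ 0` over reduced `B`. Every V3 inhabitant is a V4 (rev 0.7) inhabitant (`PnegaInterfaceV3.toV4`).
NOT a statement of the manuscript. VACUITY: INHABITED — `PnegaInterfaceV4.bypass` / `nonempty_bypass` (diagnostic inhabitant,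
fails F7c); the printed candidate `PnegaInterfaceV2.printedTilde` is known NOT to inhabit it (F1 ✗, F7b ✗ — R01/R04). [folklore] -/
structure PnegaInterfaceV4 (K : Type u) [CommRing K] (p : ℕ) (prov : PnegaProvenance.{u, v} K) :
    Type (max u (v + 1)) where
  /-- the candidate: `tilde B P i` = «℘̃(E,i)», an additive subgroup of `B` in each degree (as V2) -/
  tilde : ∀ {B : Type v} [CommRing B] [Algebra K B], (ℕ → Ideal B) → ℤ → AddSubgroup B
  /-- F2 / O4 — positive part untouched (V2 `pos_eq`, guarded) -/
  pos_eq : ∀ {B : Type v} [CommRing B] [Algebra K B] (P : ℕ → Ideal B), IsCharFiltration K P →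
    ∀ i : ℕ, 0 < i → tilde P (i : ℤ) = (P i).toAddSubgroup
  /-- F2 — product rule Lem 5.8 p.28 L7–L8 (V2 `mul_mem`, guarded; res-adj-1 E-A) -/
  mul_mem : ∀ {B : Type v} [CommRing B] [Algebra K B] (P : ℕ → Ideal B), IsCharFiltration K P →
    ∀ (i j : ℤ) (a b : B), a ∈ tilde P i → b ∈ tilde P j → a * b ∈ tilde P (i + j)
  /-- F8 — antitone in NEGATIVE degrees `i ≤ j < 0` (Lem 5.9 (1),(3) p.28 L18–L26 restricted, C6; rev 0.6 C8′: the edge `j = 0`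
  of V3 is dropped — print has `1 ∈ ℘(E,0) ⊆ ℘̃(E,0)`, Th 4.1, so degree 0 is isolated; positive degrees are the guard's; the
  cross-boundary inclusion `P j ⊆ tilde P i`, `i ≤ 0 < j`, is obligation O6 and is NOT demanded — with `DiffStableNeg` it is the
  collapse, E-E). The field NAME is kept for the consumers' sake (res-D-plan-1 rev 0.6). -/
  antitone_nonpos : ∀ {B : Type v} [CommRing B] [Algebra K B] (P : ℕ → Ideal B), IsCharFiltration K P →
    ∀ i j : ℤ, i ≤ j → j < 0 → tilde P j ≤ tilde P i
  /-- F9 — `p`-th-root closure in degrees `≤ 0` over REDUCED algebras (U54L42 p.54, Th 9.18 p.55 L34–L37 / proof p.56 L1–L2;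
  convention `p·i ↦ i` CONFIRMED by res-adj-1 C3; guards C2 + C7) -/
  root_closed : ∀ {B : Type v} [CommRing B] [Algebra K B] [IsReduced B] (P : ℕ → Ideal B), IsCharFiltration K P →
    ∀ (b : B) (i : ℤ), i ≤ 0 → b ^ p ∈ tilde P (p * i) → b ∈ tilde P i
  /-- F7b — the negative pieces contain NO UNIT at a (37)-placement («F7b-unit», res-D-plan-1 ruling 02:09:04Z on director
  02:04:38Z / res-adj-1 02:02:05Z: for AddSubgroup- or module-valued candidates the literal «≠ ⊤» of V2 `neg_proper` is too
  weak — `K·1 ≠ ⊤` — so the demand of record is `IsUnit u → u ∉ tilde P (−a)`; for ideal-valued candidates the two agree, and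
  `neg_ne_top_of_neg_proper` recovers «≠ ⊤»); sources Def 5.1 p.25 l.42–44, Rem 5.4 p.26, (110) p.69 L29–L31, Th 15.9 p.79
  L16–L17, U86L16 p.86; the stronger «⊆ 𝔪_ξ / ⊆ I(Sing)» placement is F6a `neg_le_sing`. -/
  neg_proper : ∀ {B : Type v} [CommRing B] [Algebra K B] (P : ℕ → Ideal B), IsCharFiltration K P →
    ∀ (q : ℕ) (g : B), 0 < q → g ∈ P q → (∀ k : ℕ, 0 < k → diffIdeal K (k * q) (Ideal.span {g ^ k}) = ⊤) → P q ≠ ⊤ →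
      ∀ a : ℕ, 0 < a → ∀ u : B, IsUnit u → u ∉ tilde P (-(a : ℤ))
  /-- F1 — transform law (59) in one chart, first inclusion (V2 `transform_mem`, unchanged) -/
  transform_mem : ∀ {B B' : Type v} [CommRing B] [CommRing B'] [Algebra K B] [Algebra K B']
    (φ : B →ₐ[K] B') (x : B') (P : ℕ → Ideal B) (P' : ℕ → Ideal B'), prov.IsChart φ x P P' →
      ∀ (a : ℕ) (f : B), f ∈ tilde P (-(a : ℤ)) → x ^ a * φ f ∈ tilde P' (-(a : ℤ))
  /-- F1, second inclusion (V2 `transform_le`, unchanged) -/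
  transform_le : ∀ {B B' : Type v} [CommRing B] [CommRing B'] [Algebra K B] [Algebra K B']
    (φ : B →ₐ[K] B') (x : B') (P : ℕ → Ideal B) (P' : ℕ → Ideal B'), prov.IsChart φ x P P' →
      ∀ a : ℕ, (tilde P' (-(a : ℤ)) : Set B') ⊆
        (Ideal.span ((fun f : B => x ^ a * φ f) '' (tilde P (-(a : ℤ)) : Set B)) : Set B')
  /-- F4 — compatibility with COMPLETION-type base change `φ : B → B'` (first inclusion `φ(℘̃(i)) ⊂ ℘̃'(i)`): the role
  consumed inside the proofs of Th 6.3 (p.31 l.48–50 «K[[s]] is faithfully flat over O_ξ», Th 6.6 row 039) and of Th 7.10 /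
  Th 7.11 (p.38 l.20–23). RE-SOURCED after res-ref-a7 OURS-DESK #65 (4) 2026-08-27T01:46:36Z: Eq. (49) p.32 L6–L7 (tree
  `S06BaseHike.Eq49`) is NOT this demand — it is the single-ring kernel criterion `℘nega(Ê,−a) ⊂ Ker σ` for the MAXIMUM
  BASE-HIKE `Ê` (§6.1 p.29 l.17–19), tracked outside the interface by Q-06-004 (Th 6.5 R2 kernel); V2's «Eq. (49)-shape»
  wording is withdrawn. Field text = V2 `baseChange_mem`, unchanged. -/
  baseChange_mem : ∀ {B B' : Type v} [CommRing B] [CommRing B'] [Algebra K B] [Algebra K B']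
    (φ : B →ₐ[K] B') (P : ℕ → Ideal B) (P' : ℕ → Ideal B'), prov.IsCompletion φ P P' →
      ∀ (i : ℤ) (f : B), f ∈ tilde P i → φ f ∈ tilde P' i
  /-- F4, second inclusion `℘̃'(i) ⊂ φ(℘̃(i))B'` (V2 `baseChange_le`, text unchanged; sources as `baseChange_mem`). -/
  baseChange_le : ∀ {B B' : Type v} [CommRing B] [CommRing B'] [Algebra K B] [Algebra K B']
    (φ : B →ₐ[K] B') (P : ℕ → Ideal B) (P' : ℕ → Ideal B'), prov.IsCompletion φ P P' →
      ∀ i : ℤ, (tilde P' i : Set B') ⊆ (Ideal.span (φ '' (tilde P i : Set B)) : Set B')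
  /-- F6a — `℘nega(E,−a) ⊂ I(Sing E)` for `a > 0`: the demand is row 015's R08(α) binder `hN : pnega ≤ span{C a·T d : a ∈ I}`
  of `Def13p2Carrier.lean :: TFlat_subset_ideal` / `Cot_subset_radical` / `Cot_ne_top_of_subset` (p475363), read with Def 13.2
  (105)–(106) p.67 L16–L22; re-worded after res-ref-a7 #65 (5): p.67 L15 itself places `𝔏₀(∞)`, not `℘nega`, inside
  `I(Sing)Bl(Z)`. Field text = V2 `neg_le_sing`, unchanged. -/
  neg_le_sing : ∀ {B : Type v} [CommRing B] [Algebra K B] (P : ℕ → Ideal B) (I : Ideal B),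
    prov.IsSingIdeal P I → ∀ a : ℕ, 0 < a → tilde P (-(a : ℤ)) ≤ I.toAddSubgroup

namespace PnegaInterfaceV4

open PnegaInterfaceV3 (emptyProvenance bypassTilde bypassTilde_of_pos bypassTilde_of_nonpos)

/-! ## §2 Scored predicates and in-file consequences over V4 (rev 0.7) -/

variable {K : Type u} [CommRing K] {p : ℕ} {prov : PnegaProvenance.{u, v} K}

/-- F3⁻ as a SCORED PREDICATE (rev 0.7; was the field `diff_mem_neg` of V3 p487629): Diff-stability from NEGATIVE source degrees,
Grothendieck family `IsDiffOpLE K μ` (res-adj-1 C1: Def 5.1 (36) p.25 restricted; print-derived, faithful to Def 5.1 p.25 L34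
«O_Z-submodule»). ✗-CLASS: with F7b-unit it forces every negative piece to `⊥` at a regular local placement
(`not_nonVanishing_of_diffStableNeg_hsLocalDatum` below; res-D-pv-031 `PnegaObligation.tilde_neg_eq_bot_of_F3hs_of_negProper` ∘
`F3hsAt_of_F3negAllAt`, p490404); at `μ = 0` it gives `mul_mem_neg` (E-H). The consumers' Diff demands are the separate obligations
F3.1–F3.4. NOT a statement of the manuscript; asserted of no candidate. [folklore] -/
def DiffStableNeg (I : PnegaInterfaceV4 K p prov) : Prop :=
  ∀ {B : Type v} [CommRing B] [Algebra K B] (P : ℕ → Ideal B), IsCharFiltration K P →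
    ∀ (μ : ℕ) (D : B →ₗ[K] B), IsDiffOpLE K μ D → ∀ i : ℤ, i < 0 → ∀ f : B, f ∈ I.tilde P i → D f ∈ I.tilde P (i - μ)

/-- [OURS · L1 G1 · F6d-elt] (V2/V3 text verbatim over V4): every element of every negative piece is a `p^e`-th power — the
element-wise reading of Th 14.11 R2's norm clause (p.72 L30 – p.73 L10); NOT a statement of the manuscript. [folklore] -/
def NormDemand (I : PnegaInterfaceV4 K p prov) (e : ℕ) : Prop :=
  ∀ {B : Type v} [CommRing B] [Algebra K B] (P : ℕ → Ideal B) (a : ℕ), 0 < a →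
    (I.tilde P (-(a : ℤ)) : Set B) ⊆ Set.range fun b : B => b ^ p ^ e

/-- [OURS · L1 G1 · F6c] (V2/V3 text verbatim over V4): the candidate's pieces are `O`-stable (Def 5.1 «O_Z-submodule» p.25 L34 as a
SCORED cell); NOT a statement of the manuscript. Under `DiffStableNeg` it is forced in negative degrees (E-H, `mul_mem_neg`). [folklore] -/
def OStable (I : PnegaInterfaceV4 K p prov) : Prop :=
  ∀ {B : Type v} [CommRing B] [Algebra K B] (P : ℕ → Ideal B) (i : ℤ) (r x : B),
    x ∈ I.tilde P i → r * x ∈ I.tilde P i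

/-- [OURS · L1 G1 · F7c] (v0.3 text, guarded; verbatim over V4): at a guarded filtration with a (37)-datum SOME negative piece is
non-zero (binders `pnega ≠ ⊥` of Thm14p11R2b/c, (110) p.69 L29–L31, Th 15.9 p.79 L16–L17); NOT a statement of the manuscript. [folklore] -/
def NonVanishing (I : PnegaInterfaceV4 K p prov) : Prop :=
  ∀ {B : Type v} [CommRing B] [Algebra K B] (P : ℕ → Ideal B), IsCharFiltration K P →
    ∀ (q : ℕ) (g : B), 0 < q → g ∈ P q → (∀ k : ℕ, 0 < k → diffIdeal K (k * q) (Ideal.span {g ^ k}) = ⊤) → P q ≠ ⊤ →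
      ∃ a : ℕ, 0 < a ∧ I.tilde P (-(a : ℤ)) ≠ ⊥

/-- In positive degrees the guard gives antitonicity for free (so F8 needs no positive clause). [folklore] -/
theorem antitone_pos (I : PnegaInterfaceV4 K p prov) {B : Type v} [CommRing B] [Algebra K B] (P : ℕ → Ideal B)
    (hP : IsCharFiltration K P) (i j : ℕ) (hi : 0 < i) (hij : i ≤ j) : I.tilde P (j : ℤ) ≤ I.tilde P (i : ℤ) := by
  rw [I.pos_eq P hP i hi, I.pos_eq P hP j (lt_of_lt_of_le hi hij)]
  intro f hf
  exact hP.2.1 i j hij hf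

/-- F7b-unit implies the V2 wording «≠ ⊤». [folklore] -/
theorem neg_ne_top_of_neg_proper (I : PnegaInterfaceV4 K p prov) {B : Type v} [CommRing B] [Algebra K B]
    (P : ℕ → Ideal B) (hP : IsCharFiltration K P) (q : ℕ) (g : B) (hq : 0 < q) (hg : g ∈ P q)
    (h37 : ∀ k : ℕ, 0 < k → diffIdeal K (k * q) (Ideal.span {g ^ k}) = ⊤) (hPq : P q ≠ ⊤) (a : ℕ) (ha : 0 < a) :
    I.tilde P (-(a : ℤ)) ≠ ⊤ := by
  intro htop
  exact I.neg_proper P hP q g hq hg h37 hPq a ha 1 isUnit_one (htop ▸ AddSubgroup.mem_top 1)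

/-- **E-H** (res-D-pv-031, rev 0.6 record; ruling res-D-plan-1 02:50:27Z (1)): `Diff^{(0)} ∋ (b · )` for every `b`
(`Resolution.isDiffOpLE_mulLeft`), so F3⁻ (`DiffStableNeg`) makes every NEGATIVE piece `B`-stable at a guarded `P` —
faithful to Def 5.1 p.25 L34 «O_Z-submodule». With F6d-elt this feeds the squeeze (res-type-087 SqueezeV3;
`Lib/PowIdeal.addSubgroup_eq_bot_of_mul_mem_of_subset_range_pow`). [folklore] -/
theorem mul_mem_neg (I : PnegaInterfaceV4 K p prov) (h : I.DiffStableNeg) {B : Type v} [CommRing B] [Algebra K B]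
    (P : ℕ → Ideal B) (hP : IsCharFiltration K P) {i : ℤ} (hi : i < 0) (b x : B) (hx : x ∈ I.tilde P i) :
    b * x ∈ I.tilde P i := by
  simpa using h P hP 0 (LinearMap.mulLeft K b) (isDiffOpLE_mulLeft b) i hi x hx

/-! ## §3 The diagnostic inhabitant («⊥-bypass») of V4 (rev 0.7) — B6 satisfiability witness; value and provenance reused from V3 -/
/-- [diagnostic · B6 satisfiability witness] The «⊥-bypass» inhabits the v0.7 checklist at the empty provenance: E-A … E-F cannot be replayed. It is NOT a
candidate for the manuscript's `℘nega` — it fails F7c `NonVanishing` (`bypass_not_nonVanishing_of_datum`). [folklore] -/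
def bypass (K : Type u) [CommRing K] (p : ℕ) : PnegaInterfaceV4 K p (emptyProvenance.{u, v} K) where
  tilde := fun P i => bypassTilde P i
  pos_eq := by
    intro B _ _ P _ i hi
    have hi' : (0 : ℤ) < (i : ℤ) := by exact_mod_cast hi
    simp [bypassTilde_of_pos P hi']
  mul_mem := by
    intro B _ _ P hP i j a b ha hb
    by_cases hi : 0 < i
    · by_cases hj : 0 < j
      · rw [bypassTilde_of_pos P hi] at ha
        rw [bypassTilde_of_pos P hj] at hb
        have hij : 0 < i + j := by omega
        rw [bypassTilde_of_pos P hij]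
        have hnat : (i + j).toNat = i.toNat + j.toNat := by omega
        change a * b ∈ P (i + j).toNat
        rw [hnat]
        exact hP.2.2.1 _ _ (Ideal.mul_mem_mul ha hb)
      · rw [bypassTilde_of_nonpos P (not_lt.1 hj)] at hb
        have hb0 : b = 0 := by simpa using hb
        simp [hb0]
    · rw [bypassTilde_of_nonpos P (not_lt.1 hi)] at ha
      have ha0 : a = 0 := by simpa using ha
      simp [ha0]
  antitone_nonpos := by
    intro B _ _ P _ i j _ hj
    simp [bypassTilde_of_nonpos P (le_of_lt hj)]
  root_closed := by
    intro B _ _ _ P _ b i hi hb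
    have hpi : (p : ℤ) * i ≤ 0 := by
      have : (0 : ℤ) ≤ p := by exact_mod_cast Nat.zero_le p
      nlinarith
    rw [bypassTilde_of_nonpos P hpi] at hb
    have hb0 : b ^ p = 0 := by simpa using hb
    have hb' : b = 0 := IsReduced.eq_zero b ⟨p, hb0⟩
    simp [bypassTilde_of_nonpos P hi, hb']
  neg_proper := by
    intro B _ _ P _ q g _ _ _ hPq a ha u hu hmem
    have ha' : (-(a : ℤ)) ≤ 0 := by omega
    rw [bypassTilde_of_nonpos P ha'] at hmem
    have hu0 : u = 0 := by simpa using hmem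
    rw [hu0, isUnit_zero_iff] at hu
    exact hPq ((Ideal.eq_top_iff_one _).2 (by rw [← hu]; exact (P q).zero_mem))
  transform_mem := fun _ _ _ _ h => h.elim
  transform_le := fun _ _ _ _ h => h.elim
  baseChange_mem := fun _ _ _ h => h.elim
  baseChange_le := fun _ _ _ h => h.elim
  neg_le_sing := fun _ _ h => h.elim

/-- [B6 satisfiability witness, res-adj-1's regression test] The v0.7 checklist is INHABITED (at the empty provenance, for every
`K`, `p`): an empty checklist scores nothing (director-resolution 2026-08-27T01:55:25Z (1)). [folklore] -/
theorem nonempty_bypass (K : Type u) [CommRing K] (p : ℕ) :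
    Nonempty (PnegaInterfaceV4 K p (emptyProvenance.{u, v} K)) :=
  ⟨bypass K p⟩

/-- The bypass is `O`-stable (F6c ✓, trivially: its negative pieces are `⊥`, its positive pieces are ideals) … [folklore] -/
theorem bypass_oStable (K : Type u) [CommRing K] (p : ℕ) : (bypass.{u, v} K p).OStable := by
  intro B _ _ P i r x hx
  by_cases hi : 0 < i
  · change x ∈ bypassTilde P i at hx
    change r * x ∈ bypassTilde P i
    rw [bypassTilde_of_pos P hi] at hx ⊢
    exact (P i.toNat).mul_mem_left r hx
  · change x ∈ bypassTilde P i at hx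
    change r * x ∈ bypassTilde P i
    rw [bypassTilde_of_nonpos P (not_lt.1 hi)] at hx ⊢
    have hx0 : x = 0 := by simpa using hx
    simp [hx0]

/-- … and meets the element-wise norm demand F6d-elt for `0 < p` (trivially: `0 = 0^(p^e)`) … [folklore] -/
theorem bypass_normDemand (K : Type u) [CommRing K] {p : ℕ} (hp : 0 < p) (e : ℕ) :
    (bypass.{u, v} K p).NormDemand e := by
  intro B _ _ P a ha f hf
  have ha' : (-(a : ℤ)) ≤ 0 := by omega
  change f ∈ (bypassTilde P (-(a : ℤ)) : Set B) at hf
  rw [bypassTilde_of_nonpos P ha'] at hf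
  have hf0 : f = 0 := by simpa using hf
  exact ⟨0, by simp [hf0, zero_pow (pow_ne_zero e (Nat.pos_iff_ne_zero.1 hp))]⟩

/-- … and therefore FAILS F7c at any (37)-placement: all its negative pieces vanish. This is what makes F7c the discriminating
cell of the scoring protocol (decisive cell F6c × F6d × F7c). [folklore] -/
theorem bypass_not_nonVanishing_of_datum (K : Type u) [CommRing K] (p : ℕ)
    {B : Type v} [CommRing B] [Algebra K B] (P : ℕ → Ideal B) (hP : IsCharFiltration K P) (q : ℕ) (g : B)
    (hq : 0 < q) (hg : g ∈ P q) (h37 : ∀ k : ℕ, 0 < k → diffIdeal K (k * q) (Ideal.span {g ^ k}) = ⊤) (hPq : P q ≠ ⊤) :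
    ¬ (bypass.{u, v} K p).NonVanishing := by
  intro hNV
  obtain ⟨a, ha, hne⟩ := hNV P hP q g hq hg h37 hPq
  have ha' : (-(a : ℤ)) ≤ 0 := by omega
  exact hne (bypassTilde_of_nonpos P ha')

/-- The bypass is (trivially) Diff-stable from negative sources: they are `⊥` (res-D-plan-1 rev 0.7). [folklore] -/
theorem bypass_diffStableNeg (K : Type u) [CommRing K] (p : ℕ) : (bypass.{u, v} K p).DiffStableNeg := by
  intro B _ _ P _ μ D _ i hi f hf
  change f ∈ bypassTilde P i at hf
  change D f ∈ bypassTilde P (i - μ)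
  rw [bypassTilde_of_nonpos P (le_of_lt hi)] at hf
  have hf0 : f = 0 := by simpa using hf
  have hle : i - (μ : ℤ) ≤ 0 := by omega
  simp [hf0, bypassTilde_of_nonpos P hle]

/-! ## §4 The bridge V3 → V4 (rev 0.7) (V4 (rev 0.7) drops F3⁻ and weakens F8; `tilde` unchanged) -/
/-- Every inhabitant of `PnegaInterfaceV3` (p487629) IS an inhabitant of V4 (rev 0.7) with the same `tilde`: all remaining fields are copied, F8 is
restricted from `j ≤ 0` to `j < 0`, and V3's field `diff_mem_neg` becomes the predicate `DiffStableNeg` (`toV4_diffStableNeg`). So every theorem about V3 inhabitants applies to `I.toV4`-preimages verbatim, and the scored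
predicates transfer by `Iff.rfl` (below). [folklore] -/
def _root_.Summit.ResolutionOfSingularities.ResolutionOfSingularities.Theorems.Campaign.PnegaInterfaceV3.toV4
    (I : PnegaInterfaceV3 K p prov) : PnegaInterfaceV4 K p prov where
  tilde := I.tilde
  pos_eq := I.pos_eq
  mul_mem := I.mul_mem
  antitone_nonpos := fun P hP i j hij hj => I.antitone_nonpos P hP i j hij (le_of_lt hj)
  root_closed := I.root_closed
  neg_proper := I.neg_proper
  transform_mem := I.transform_mem
  transform_le := I.transform_le
  baseChange_mem := I.baseChange_mem
  baseChange_le := I.baseChange_le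
  neg_le_sing := I.neg_le_sing

/-- The bridge keeps the candidate value (by `rfl`). [folklore] -/
@[simp] theorem toV4_tilde (I : PnegaInterfaceV3 K p prov) {B : Type v} [CommRing B] [Algebra K B] (P : ℕ → Ideal B)
    (i : ℤ) : I.toV4.tilde P i = I.tilde P i := rfl

/-- F6d-elt transfers along the bridge (by `Iff.rfl`). [folklore] -/
theorem toV4_normDemand_iff (I : PnegaInterfaceV3 K p prov) (e : ℕ) : I.toV4.NormDemand e ↔ I.NormDemand e := Iff.rfl
/-- F6c transfers along the bridge (by `Iff.rfl`). [folklore] -/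
theorem toV4_oStable_iff (I : PnegaInterfaceV3 K p prov) : I.toV4.OStable ↔ I.OStable := Iff.rfl
/-- F7c transfers along the bridge (by `Iff.rfl`). [folklore] -/
theorem toV4_nonVanishing_iff (I : PnegaInterfaceV3 K p prov) : I.toV4.NonVanishing ↔ I.NonVanishing := Iff.rfl
/-- V3's FIELD F3⁻ is V4 (rev 0.7)'s predicate: every V3 inhabitant is `DiffStableNeg` after the bridge. [folklore] -/
theorem toV4_diffStableNeg (I : PnegaInterfaceV3 K p prov) : I.toV4.DiffStableNeg :=
  fun P hP μ D hD i hi f hf => I.diff_mem_neg P hP μ D hD i hi f hf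

/-! ## §5 The headline: F2 × F8⁻ × F6d-elt EXCLUDE F7c for every inhabitant (res-D-plan-1 03:44:20Z (2); kernel res-type-087 p492397) -/

open IsLocalRing in
/-- [OURS · L1 G1 ℘nega-INTERFACE V4 · F2 × F8⁻ × F6d-elt ⇒ negative pieces `⊥`, placement as hypotheses — NO Diff-stability, NO `OStable`]
For every inhabitant `I : PnegaInterfaceV4 K p prov` meeting F6d-elt `NormDemand e` (`p^e ≥ 2`): at every regular local `K`-algebra `B`
of positive dimension (`max(B) ≠ 0`) and every guard-admissible `P` with `P 1 ≠ 0`, every negative piece vanishes. Fields used: `pos_eq`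
(at `i = 1`), `mul_mem` (at degrees `(1, −a−1)`), `antitone_nonpos` (at `−2 ≤ −1 < 0`) — res-type-087's
`PnegaSqueeze.negPieces_eq_bot_of_ideal_mul_of_antitone_of_pow` (OBSTRUCTION #3/#4, p492397); the V3 twin is
`PnegaInterfaceV3.tilde_neg_eq_bot_of_normDemand_F2`. NOT a statement of the manuscript; asserted of no candidate. [folklore] -/
theorem tilde_neg_eq_bot_of_normDemand_F2 (I : PnegaInterfaceV4 K p prov) {e : ℕ} (hN : I.NormDemand e) (hq : 2 ≤ p ^ e)
    {B : Type v} [CommRing B] [Algebra K B] [IsRegularLocalRing B] (hm : maximalIdeal B ≠ ⊥) (P : ℕ → Ideal B)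
    (hP : IsCharFiltration K P) (hP1 : P 1 ≠ ⊥) {a : ℕ} (ha : 0 < a) : I.tilde P (-(a : ℤ)) = ⊥ := by
  refine PnegaSqueeze.negPieces_eq_bot_of_ideal_mul_of_antitone_of_pow hm hq (fun i => I.tilde P i) hP1
    (fun b hb x hx y hy => ?_) ?_ (fun b hb => hN P b hb) a ha
  · have hx1 : x ∈ I.tilde P ((1 : ℕ) : ℤ) := by
      rw [I.pos_eq P hP 1 Nat.one_pos]; exact hx
    have h := I.mul_mem P hP ((1 : ℕ) : ℤ) (-((b + 1 : ℕ) : ℤ)) x y hx1 hy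
    have hdeg : ((1 : ℕ) : ℤ) + -((b + 1 : ℕ) : ℤ) = -(b : ℤ) := by push_cast; ring
    rw [hdeg] at h
    exact h
  · exact I.antitone_nonpos P hP (-2) (-1) (by norm_num) (by norm_num)

open IsLocalRing in
/-- [OURS · L1 G1 ℘nega-INTERFACE V4 · F2 × F8⁻ × F6d-elt ⇒ ¬F7c, placement as hypotheses] An inhabitant meeting F6d-elt (`p^e ≥ 2`) FAILS
F7c `NonVanishing` as soon as ONE placement of F7c's regime is a regular local `K`-algebra of positive dimension with a guard-admissible `P`,
`P 1 ≠ 0`, and a (37)-datum. Universe-polymorphic. V3 twin: `PnegaInterfaceV3.not_nonVanishing_of_normDemand_of_placement_F2`.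
NOT a statement of the manuscript. [folklore] -/
theorem not_nonVanishing_of_normDemand_of_placement_F2 (I : PnegaInterfaceV4 K p prov) {e : ℕ} (hN : I.NormDemand e)
    (hq : 2 ≤ p ^ e) {B : Type v} [CommRing B] [Algebra K B] [IsRegularLocalRing B] (hm : maximalIdeal B ≠ ⊥)
    (P : ℕ → Ideal B) (hP : IsCharFiltration K P) (hP1 : P 1 ≠ ⊥) (q : ℕ) (g : B) (hq0 : 0 < q) (hg : g ∈ P q)
    (h37 : ∀ k : ℕ, 0 < k → diffIdeal K (k * q) (Ideal.span {g ^ k}) = ⊤) (hPq : P q ≠ ⊤) :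
    ¬ I.NonVanishing := by
  intro hNV
  obtain ⟨a, ha, hne⟩ := hNV P hP q g hq0 hg h37 hPq
  exact hne (tilde_neg_eq_bot_of_normDemand_F2 I hN hq hm P hP hP1 ha)

end PnegaInterfaceV4

namespace PnegaInterfaceV4

open IsLocalRing
open PnegaInterfaceV3 (maximalIdeal_originLocalization_one_ne_bot isCharFiltration_maximalIdeal_pow
  diffIdeal_span_X_pow_eq_top_originLocalization_one)

variable {K : Type u} [Field K] {p : ℕ} {prov : PnegaProvenance.{u, u} K}

/-- [OURS · L1 G1 ℘nega-INTERFACE V4 · **THE HEADLINE (res-D-plan-1 INTERFACE RULING 03:44:20Z (2)): F6d-elt EXCLUDES F7c FOR EVERY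
INHABITANT — NO Diff-stability, NO `OStable`**] For every FIELD `K` (any characteristic, in particular every `[CharP K p]`), every `p, e`
with `p^e ≥ 2`, every provenance `prov` and EVERY `I : PnegaInterfaceV4.{u,u} K p prov`: `I.NormDemand e → ¬ I.NonVanishing`. The fields
used are exactly the consumer-side demands the ruling KEEPS in V4 — F2 `mul_mem` across the sign boundary (Lem 5.8; the «g·h» steps of
Lem 7.10 / Th 7.11 (1), res-adj-1 DELTA 4 (a)) and F8⁻ `antitone_nonpos` below 0 (Lem 5.9; §6 (46)/(49)) — with F6d-elt (Th 14.11 norm clause,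
element reading); the placement is the origin of the line `K[x]_{(x)}` (`Resolution.OriginLocalization K 1`: regular local, `𝔪 ≠ 0` —
res-type-087 `maximalIdeal_originLocalization_one_ne_bot`; `P a = 𝔪^a` guard-admissible — `isCharFiltration_maximalIdeal_pow`; (37)-datum
`(q,g) = (1,x)` — `diffIdeal_span_X_pow_eq_top_originLocalization_one`; res-D-pv-022 OriginHsDatum p492822 for the same placement under F3⁻).
READ-OUT for the scorers: over V4 the decisive pair (F6d-elt ✓ ∧ F7c ✓) is impossible among inhabitants — OBSTRUCTION #3/#4 p492397 in the
kernel of the instrument; candidates escaping it must drop a FIELD (F2± or F8⁻: a CONSUMER price, res-D-plan-1 (3)), i.e. are data-level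
objects scored outside the structure (PW p492701). V3 twin (via F3⁻, stronger): `PnegaInterfaceV3.not_nonVanishing_affineLine` p492822.
NOT a statement of the manuscript; ✓/✗ remain the scorers' words. VACUITY: not vacuous — `bypass` meets the hypothesis (`bypass_normDemand`)
and the structure is inhabited (`nonempty_bypass`). [folklore] -/
theorem not_nonVanishing_of_normDemand (I : PnegaInterfaceV4.{u, u} K p prov) {e : ℕ} (hN : I.NormDemand e) (he : 2 ≤ p ^ e) :
    ¬ I.NonVanishing :=
  not_nonVanishing_of_normDemand_of_placement_F2 I hN he (maximalIdeal_originLocalization_one_ne_bot K)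
    (fun a : ℕ => maximalIdeal (OriginLocalization K 1) ^ a) (isCharFiltration_maximalIdeal_pow K)
    (by rw [pow_one]; exact maximalIdeal_originLocalization_one_ne_bot K) 1
    (algebraMap (MvPolynomial (Fin 1) K) (OriginLocalization K 1) (MvPolynomial.X 0))
    Nat.one_pos (by rw [pow_one]; exact algebraMap_X_mem_maximalIdeal_originLocalization K 1 0)
    (fun k _ => diffIdeal_span_X_pow_eq_top_originLocalization_one K k)
    (by rw [pow_one]; exact (maximalIdeal.isMaximal (OriginLocalization K 1)).ne_top)

end PnegaInterfaceV4

end Summit.ResolutionOfSingularities.ResolutionOfSingularities.Theorems.Campaign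

end
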